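import Summits.QuantumFields.YangMills.Theorems.BalabanUVNodesN07DbarHQnearGuards
import HarnessLib

/-!
# N07 [B11] (= [15] = [Balaban1985Variational]) Sect. F — MODULE 99″-GUARDS: **THE NUMERIC GUARDS OF 99″∕100⁵ HOLD FOR SMALL POSITIVE `a₀`, `a₁` AT `Ψ ε j := ψc·(κ·ε_j)²`** (any `L`,
# `Mc`, `ρ`, `κ ≥ 0`, `ψc ≥ 0`, `N ≥ 1`) — the `exists_guards_dbar` twin (MODULE 99-guards) for the E-edition: the seven `a₀`∕`a₁` guards AND the per-level defect guards (sign, `≤ 1∕32`,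
# range `X₀′·a₁ + 2Ω_j ≤ ½`) are jointly satisfiable; so the K0 assembler's choice «`a₀`, `a₁` small after `ρ`, `Mc`, `κ`, `ψc`» (print (163) p. 304) is consistent with 100⁵'s guard list

Cell `pub-ymgap`, seat `pub-ymgap-dag-n07-e` g30 (FAN-OUT §N07 row s3; LANE OWNER of the K0 road chart side).  `--kind proof --supports stmt-QuantumFields-20541 --as helper` (K0⁷);
count-neutral; ONE theorem (0 `def`); elementary real arithmetic.  HONEST SCOPE: satisfiability of MY guard list only — the budget row, `HThm4RecSym152PhiE`, HSEAM are NOT touched; K0⁷ NOT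
closed; N07 NOT discharged; counts unmoved; the YM mass gap (Clay) is NOT proved by any of this; nothing continuum ∕ ℝ⁴ ∕ OS.  No `def`, no `instance`, no `notation`, no `sorry`.

References: [15] (163) p. 304; [3] = [Balaban1985Averaging] (26) p. 22, (78)–(81) p. 30; [I] = [Balaban1987RG1] (0.6) p. 253.
-/

set_option autoImplicit false

noncomputable section

namespace Summit.QuantumFields.YangMills.BalabanUVNodes.N07SymHQnearPhiEGuards

open Literature.MathematicalPhysics.QuantumFieldTheory.Balaban1983to89
open T4Continuum (T4Family)
open ExpMeanLog (deltaSU deltaSU_pos)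
open FederbushMean (federbushSU deltaFed deltaFed_pos federbushSU_δ)
open B8Eq131Cubes (crad)

variable (F : T4Family) (N : ℕ) [NeZero N]

set_option maxHeartbeats 800000 in
/-- ★ **THE GUARDS OF 99″∕100⁵ HOLD FOR SMALL POSITIVE `a₀`, `a₁` AT `Ψ ε j := ψc·(κ·ε_j)²**: witnesses `a₀ := m₀∕(G + 1)`, `a₁ := m₁∕(X₀′ + T₁ + T_F + 1)` with `m₀ = min 10⁻³ (min δ_N δ_F ∕ 2)`,
`m₁ = min ¼ (min δ_N δ_F ∕ 2)`, `G = 2.4·10⁶·ℓ²·κ·L + ψc·κ²`. [cite: Balaban1985Variational, (163) p.304; Balaban1985Averaging, (26) p.22] -/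
theorem exists_guards_symPhiE (Mc ρ : ℕ) {κ ψc : ℝ} (hκ : 0 ≤ κ) (hψc : 0 ≤ ψc) :
    ∃ a₀ a₁ : ℝ, 0 < a₀ ∧ 0 < a₁ ∧
      243200 * (((4 + 2) * F.L : ℕ) : ℝ) ^ 2 * (κ * a₀ * (F.L : ℝ)) ≤ 1 ∧
      60 * (((4 + 2) * F.L : ℕ) : ℝ) ^ 2 * (κ * a₀ * (F.L : ℝ)) < deltaSU (Fin N) ∧
      5760 * (((4 + 2) * F.L : ℕ) : ℝ) ^ 2 * (κ * a₀ * (F.L : ℝ)) < deltaFed (Fin N) ∧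
      2880 * (((4 + 2) * F.L : ℕ) : ℝ) ^ 2 * (κ * a₀ * (F.L : ℝ)) < deltaSU (Fin N) ∧
      240 * (((4 + 2) * F.L : ℕ) : ℝ) ^ 2 * (κ * a₀ * (F.L : ℝ)) ≤ 1 / 10000 ∧
      ((((4 + 2) * F.L : ℕ) : ℝ) ^ 2 / 4) * (4 * (((4 - 1 : ℕ) : ℝ) * ((2 * F.L - 1 : ℕ) : ℝ)) + 1) * a₁ < deltaSU (Fin N) ∧
      2 * (((4 * ((F.L - 1) / 2) : ℕ) : ℝ) * ((((4 - 1 : ℕ) : ℝ) * ((F.L - 1 : ℕ) : ℝ)) * a₁)) < (federbushSU (n := Fin N)).δ ∧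
      ∀ (ε : ℕ → ℝ) (j : ℕ), 0 ≤ ε j → ε j ≤ a₀ → 0 ≤ ψc * (κ * ε j) ^ 2 ∧ ψc * (κ * ε j) ^ 2 ≤ 1 / 32 ∧
        (((4 - 1 : ℕ) : ℝ) * ((crad (ρ * ((Mc + 11 * 4) / ρ + 2)) ρ : ℕ) : ℝ) * (1 + 2 * (((F.L : ℝ) ^ 2 + 6 * (((4 + 2) * F.L : ℕ) : ℝ) ^ 2) * (4 * (((4 - 1 : ℕ) : ℝ) * ((2 * F.L - 1 : ℕ) : ℝ)) + 1))) + 14 * ((((4 + 2) * F.L : ℕ) : ℝ) ^ 2 / 4 * (4 * (((4 - 1 : ℕ) : ℝ) * ((2 * F.L - 1 : ℕ) : ℝ)) + 1)) + 2 * (((4 + 1) * (F.L - 1) : ℕ) : ℝ) * ((((14 * (4 * ((F.L - 1) / 2)) + 1 : ℕ) : ℝ)) * (((4 - 1 : ℕ) : ℝ) * ((F.L - 1 : ℕ) : ℝ)))) * a₁ +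
          2 * ((100 * (240 * (((4 + 2) * F.L : ℕ) : ℝ) ^ 2 * (κ * ε j * (F.L : ℝ))) ^ 2 + 6 * (ψc * (κ * ε j) ^ 2) + 100 * (240 * (((4 + 2) * F.L : ℕ) : ℝ) ^ 2 * (κ * ε j * (F.L : ℝ))) ^ 2 * (6 * (ψc * (κ * ε j) ^ 2))) + (100 * (240 * (((4 + 2) * F.L : ℕ) : ℝ) ^ 2 * (κ * ε j * (F.L : ℝ))) ^ 2 + 6 * (ψc * (κ * ε j) ^ 2) + 100 * (240 * (((4 + 2) * F.L : ℕ) : ℝ) ^ 2 * (κ * ε j * (F.L : ℝ))) ^ 2 * (6 * (ψc * (κ * ε j) ^ 2))) + (100 * (240 * (((4 + 2) * F.L : ℕ) : ℝ) ^ 2 * (κ * ε j * (F.L : ℝ))) ^ 2 + 6 * (ψc * (κ * ε j) ^ 2) + 100 * (240 * (((4 + 2) * F.L : ℕ) : ℝ) ^ 2 * (κ * ε j * (F.L : ℝ))) ^ 2 * (6 * (ψc * (κ * ε j) ^ 2))) * (100 * (240 * (((4 + 2) * F.L : ℕ) : ℝ) ^ 2 * (κ * ε j * (F.L : ℝ)))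 ^ 2 + 6 * (ψc * (κ * ε j) ^ 2) + 100 * (240 * (((4 + 2) * F.L : ℕ) : ℝ) ^ 2 * (κ * ε j * (F.L : ℝ))) ^ 2 * (6 * (ψc * (κ * ε j) ^ 2)))) ≤ 1 / 2 := by
  have hδN : 0 < deltaSU (Fin N) := deltaSU_pos
  have hδF : 0 < deltaFed (Fin N) := deltaFed_pos
  -- opaque atoms
  obtain ⟨kc, hkc⟩ : ∃ kc : ℝ, kc = (((14 * (4 * ((F.L - 1) / 2)) + 1 : ℕ) : ℝ)) := ⟨_, rfl⟩
  obtain ⟨kF, hkF⟩ : ∃ kF : ℝ, kF = (((4 * ((F.L - 1) / 2) : ℕ) : ℝ)) := ⟨_, rfl⟩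
  rw [← hkc, ← hkF]
  have hkc0 : 0 ≤ kc := by rw [hkc]; exact Nat.cast_nonneg _
  have hkF0 : 0 ≤ kF := by rw [hkF]; exact Nat.cast_nonneg _
  obtain ⟨ℓ2, hℓ2⟩ : ∃ ℓ2 : ℝ, ℓ2 = (((4 + 2) * F.L : ℕ) : ℝ) ^ 2 := ⟨_, rfl⟩
  rw [← hℓ2]
  have hℓ20 : 0 ≤ ℓ2 := by rw [hℓ2]; positivity
  have hL0 : (0 : ℝ) ≤ F.L := Nat.cast_nonneg _
  obtain ⟨X0, hX0⟩ : ∃ X0 : ℝ, X0 = ((((4 - 1 : ℕ) : ℝ) * ((crad (ρ * ((Mc + 11 * 4) / ρ + 2)) ρ : ℕ) : ℝ) * (1 + 2 * (((F.L : ℝ) ^ 2 + 6 * ℓ2) * (4 * (((4 - 1 : ℕ) : ℝ) * ((2 * F.L - 1 : ℕ) : ℝ)) + 1))) + 14 * (ℓ2 / 4 * (4 * (((4 - 1 : ℕ) : ℝ) * ((2 * F.L - 1 : ℕ) : ℝ)) + 1)) + 2 * (((4 + 1) * (F.L - 1) : ℕ) : ℝ) * (kc * ((((4 - 1 : ℕ)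 : ℝ) * ((F.L - 1 : ℕ) : ℝ)))))) := ⟨_, rfl⟩
  rw [← hX0]
  have hX00 : 0 ≤ X0 := by rw [hX0]; positivity
  obtain ⟨T₁, hT₁⟩ : ∃ T₁ : ℝ, T₁ = (ℓ2 / 4) * (4 * (((4 - 1 : ℕ) : ℝ) * ((2 * F.L - 1 : ℕ) : ℝ)) + 1) := ⟨_, rfl⟩
  rw [← hT₁]
  have hT₁0 : 0 ≤ T₁ := by rw [hT₁]; positivity
  obtain ⟨TF, hTF⟩ : ∃ TF : ℝ, TF = 2 * (kF * (((4 - 1 : ℕ) : ℝ) * ((F.L - 1 : ℕ) : ℝ))) := ⟨_, rfl⟩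
  have hTF0 : 0 ≤ TF := by rw [hTF]; positivity
  obtain ⟨G, hG⟩ : ∃ G : ℝ, G = 2400000 * ℓ2 * (κ * (F.L : ℝ)) + ψc * κ ^ 2 := ⟨_, rfl⟩
  have hG0 : 0 ≤ G := by rw [hG]; positivity
  -- the witnesses
  set m₀ : ℝ := min (1 / 1000) (min (deltaSU (Fin N)) (deltaFed (Fin N)) / 2) with hm₀
  set m₁ : ℝ := min (1 / 4) (min (deltaSU (Fin N)) (deltaFed (Fin N)) / 2) with hm₁
  have hmin0 : 0 < min (deltaSU (Fin N)) (deltaFed (Fin N)) := lt_min hδN hδF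
  have hm₀0 : 0 < m₀ := lt_min (by norm_num) (by positivity)
  have hm₁0 : 0 < m₁ := lt_min (by norm_num) (by positivity)
  have hm₀1 : m₀ ≤ 1 / 1000 := min_le_left _ _
  have hm₀N : m₀ < deltaSU (Fin N) := lt_of_le_of_lt (min_le_right _ _) (by linarith [min_le_left (deltaSU (Fin N)) (deltaFed (Fin N))])
  have hm₀F : m₀ < deltaFed (Fin N) := lt_of_le_of_lt (min_le_right _ _) (by linarith [min_le_right (deltaSU (Fin N)) (deltaFed (Fin N))])
  have hm₁h : m₁ ≤ 1 / 4 := min_le_left _ _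
  have hm₁N : m₁ < deltaSU (Fin N) := lt_of_le_of_lt (min_le_right _ _) (by linarith [min_le_left (deltaSU (Fin N)) (deltaFed (Fin N))])
  have hm₁F : m₁ < deltaFed (Fin N) := lt_of_le_of_lt (min_le_right _ _) (by linarith [min_le_right (deltaSU (Fin N)) (deltaFed (Fin N))])
  set a₀ : ℝ := m₀ / (G + 1) with ha₀
  set a₁ : ℝ := m₁ / (X0 + T₁ + TF + 1) with ha₁
  have ha₀0 : 0 < a₀ := by positivity
  have ha₁0 : 0 < a₁ := by positivity
  -- `G·a₀ ≤ m₀`, `a₀ ≤ m₀ ≤ 1`; `(X0 + T₁ + TF)·a₁ ≤ m₁`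
  have hGa : G * a₀ ≤ m₀ := by
    rw [ha₀, mul_div_assoc']
    exact div_le_of_le_mul₀ (by positivity) hm₀0.le (by rw [mul_comm]; exact mul_le_mul_of_nonneg_left (by linarith) hm₀0.le)
  have ha₀m : a₀ ≤ m₀ := by
    rw [ha₀]; exact div_le_self hm₀0.le (by linarith)
  have ha₀1 : a₀ ≤ 1 := by linarith
  have hDa : (X0 + T₁ + TF) * a₁ ≤ m₁ := by
    rw [ha₁, mul_div_assoc']
    exact div_le_of_le_mul₀ (by positivity) hm₁0.le (by rw [mul_comm]; exact mul_le_mul_of_nonneg_left (by linarith) hm₁0.le)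
  have hsplit : (X0 + T₁ + TF) * a₁ = X0 * a₁ + T₁ * a₁ + TF * a₁ := by ring
  have hX0a0 : 0 ≤ X0 * a₁ := mul_nonneg hX00 ha₁0.le
  have hT₁a0 : 0 ≤ T₁ * a₁ := mul_nonneg hT₁0 ha₁0.le
  have hTFa0 : 0 ≤ TF * a₁ := mul_nonneg hTF0 ha₁0.le
  have hX0a : X0 * a₁ ≤ m₁ := by linarith
  have hT₁a : T₁ * a₁ ≤ m₁ := by linarith
  have hTFa : TF * a₁ ≤ m₁ := by linarith
  -- the `a₀`-products
  have hs0 : 0 ≤ κ * a₀ * (F.L : ℝ) := by positivity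
  have hℓs : 2400000 * ℓ2 * (κ * a₀ * (F.L : ℝ)) ≤ m₀ := by
    have e : 2400000 * ℓ2 * (κ * a₀ * (F.L : ℝ)) = (2400000 * ℓ2 * (κ * (F.L : ℝ))) * a₀ := by ring
    rw [e]
    have h1 : (2400000 * ℓ2 * (κ * (F.L : ℝ))) * a₀ ≤ G * a₀ := mul_le_mul_of_nonneg_right (by rw [hG]; linarith [mul_nonneg hψc (sq_nonneg κ)]) ha₀0.le
    exact h1.trans hGa
  have hψa : ψc * κ ^ 2 * a₀ ≤ m₀ := by
    have h1 : ψc * κ ^ 2 * a₀ ≤ G * a₀ :=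
      mul_le_mul_of_nonneg_right (by rw [hG]; linarith [mul_nonneg (mul_nonneg (by norm_num : (0 : ℝ) ≤ 2400000) hℓ20) (mul_nonneg hκ hL0)]) ha₀0.le
    exact h1.trans hGa
  have hℓs0 : 0 ≤ ℓ2 * (κ * a₀ * (F.L : ℝ)) := by positivity
  refine ⟨a₀, a₁, ha₀0, ha₁0, by linarith, by linarith, by linarith, by linarith, by linarith, ?_, ?_, ?_⟩
  · linarith
  · rw [federbushSU_δ]
    have e : 2 * (kF * ((((4 - 1 : ℕ) : ℝ) * ((F.L - 1 : ℕ) : ℝ)) * a₁)) = TF * a₁ := by rw [hTF]; ring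
    rw [e]; linarith
  · intro ε j hε0 hεa
    -- the level's letters are below the `a₀` ones
    have hs : κ * ε j * (F.L : ℝ) ≤ κ * a₀ * (F.L : ℝ) := mul_le_mul_of_nonneg_right (mul_le_mul_of_nonneg_left hεa hκ) hL0
    have hsj0 : 0 ≤ κ * ε j * (F.L : ℝ) := by positivity
    -- `x := 240ℓ²·s ≤ m₀∕10⁴`
    have hx : 240 * ℓ2 * (κ * ε j * (F.L : ℝ)) ≤ m₀ / 10000 := by
      have h1 : 240 * ℓ2 * (κ * ε j * (F.L : ℝ)) ≤ 240 * ℓ2 * (κ * a₀ * (F.L : ℝ)) := mul_le_mul_of_nonneg_left hs (by positivity)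
      linarith
    have hx0 : 0 ≤ 240 * ℓ2 * (κ * ε j * (F.L : ℝ)) := by positivity
    -- `φ ≤ m₀`
    have hφ : 100 * (240 * ℓ2 * (κ * ε j * (F.L : ℝ))) ^ 2 ≤ m₀ := by
      have h1 : 240 * ℓ2 * (κ * ε j * (F.L : ℝ)) ≤ 1 / 100 := by linarith
      have h2 : 240 * ℓ2 * (κ * ε j * (F.L : ℝ)) * (240 * ℓ2 * (κ * ε j * (F.L : ℝ))) ≤ 240 * ℓ2 * (κ * ε j * (F.L : ℝ)) * (1 / 100) :=
        mul_le_mul_of_nonneg_left h1 hx0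
      rw [sq]; linarith
    have hφ0 : 0 ≤ 100 * (240 * ℓ2 * (κ * ε j * (F.L : ℝ))) ^ 2 := by positivity
    -- `ψ ≤ m₀`
    have hψ : ψc * (κ * ε j) ^ 2 ≤ m₀ := by
      have h1 : ψc * (κ * ε j) ^ 2 ≤ ψc * (κ * a₀) ^ 2 :=
        mul_le_mul_of_nonneg_left (pow_le_pow_left₀ (by positivity) (mul_le_mul_of_nonneg_left hεa hκ) 2) hψc
      have h2 : ψc * (κ * a₀) ^ 2 = (ψc * κ ^ 2 * a₀) * a₀ := by ring
      have h3 : (ψc * κ ^ 2 * a₀) * a₀ ≤ m₀ * 1 := mul_le_mul hψa ha₀1 ha₀0.le hm₀0.le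
      linarith
    have hψ0 : 0 ≤ ψc * (κ * ε j) ^ 2 := by positivity
    -- `ω ≤ 8m₀`, `Ω ≤ 17m₀`
    have hω : 100 * (240 * ℓ2 * (κ * ε j * (F.L : ℝ))) ^ 2 + 6 * (ψc * (κ * ε j) ^ 2) + 100 * (240 * ℓ2 * (κ * ε j * (F.L : ℝ))) ^ 2 * (6 * (ψc * (κ * ε j) ^ 2)) ≤ 8 * m₀ := by
      have h1 : 100 * (240 * ℓ2 * (κ * ε j * (F.L : ℝ))) ^ 2 * (6 * (ψc * (κ * ε j) ^ 2)) ≤ m₀ * (6 * m₀) :=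
        mul_le_mul hφ (by linarith) (by positivity) hm₀0.le
      have h2 : m₀ * (6 * m₀) ≤ m₀ * 1 := mul_le_mul_of_nonneg_left (by linarith) hm₀0.le
      linarith
    have hω0 : 0 ≤ 100 * (240 * ℓ2 * (κ * ε j * (F.L : ℝ))) ^ 2 + 6 * (ψc * (κ * ε j) ^ 2) + 100 * (240 * ℓ2 * (κ * ε j * (F.L : ℝ))) ^ 2 * (6 * (ψc * (κ * ε j) ^ 2)) := by
      positivity
    obtain ⟨ω, hωdef⟩ : ∃ ω : ℝ, ω = 100 * (240 * ℓ2 * (κ * ε j * (F.L : ℝ))) ^ 2 + 6 * (ψc * (κ * ε j) ^ 2) + 100 * (240 * ℓ2 * (κ * ε j * (F.L : ℝ))) ^ 2 * (6 * (ψc * (κ * ε j) ^ 2)) := ⟨_, rfl⟩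
    rw [← hωdef] at hω hω0 ⊢
    have hΩ : ω + ω + ω * ω ≤ 17 * m₀ := by
      have h1 : ω * ω ≤ (8 * m₀) * (8 * m₀) := mul_le_mul hω hω hω0 (by linarith)
      have h2 : m₀ * m₀ ≤ m₀ * (1 / 64) := mul_le_mul_of_nonneg_left (by linarith) hm₀0.le
      linarith
    refine ⟨hψ0, by linarith, ?_⟩
    linarith

end Summit.QuantumFields.YangMills.BalabanUVNodes.N07SymHQnearPhiEGuards

end
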